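import Summits.Schanuel.Schanuel.Theorems.ZilberEacGraphSurfaceUnbalanced
import Summits.Schanuel.Schanuel.Theorems.ZilberEacGraphSurfaceDensity
import Summits.Schanuel.Schanuel.Theorems.ZilberEacGraphCurveInstances
import HarnessLib

/-!
# Non-split surfaces over a graph base, VI: Zariski density for EVERY fibre polynomial involving
# `y₁`; the case certificate; bases over the other axis

HONEST FRAMING.  Cell `pub-schanuel` (Zilber's Exponential-Algebraic Closedness, case ladder;
host summit Schanuel), seat 2, gen 17.  We answer Mantova–Masser's "unprojected density" question
(PLMS 129 (2024) = arXiv:2303.05592, §1 p. 5; OPEN in general) for the surfaces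

  `W(p; P) = {x₁ = p(x₀), P(x₀; y₀, y₁) = 0} ⊆ ℂ² × ℂ²`, `deg p ≥ 2`, `P ∈ ℂ[x, y₀, y₁]` irreducible
  with two monomials of different `y₁`-degree

— i.e. for EVERY irreducible `P ∉ ℂ[x, y₀]` (given irreducibility and a torus point, "`P` involves
`y₁`" is the same as "two `y₁`-degrees" unless `P = c·y₁`): **`unprojectedDense_graphSurface`**.
This supersedes gen 16's product theorem (`P ∈ ℂ[y₀, y₁]`), its balanced-edge and `x`-equidegree
theorems, and covers the unbalanced edges left open there (e.g. `y₀² + y₁² = x₀ + 2`,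
`y₁ = x₀ y₀`; `ZilberEacGraphSurfaceExamples`).  Also: the CASE CERTIFICATE for non-split `W(p; P)`
(torus fibres over infinitely many base points ⟹ `W(p; P)` is in case (dim-π-S-1-free):
`mmCase_graphSurface`), the combined statement `unprojectedDensityQuestion_instance_graphSurface`,
and graphs over the other axis (`unprojectedDense_graphSurface_swap`).  What is NOT covered
(precisely): `P ∈ ℂ[x₀, y₀]` (the exponential points are then governed by the zeros of
`P(z, e^z)`, which do not escape; a different mechanism), non-graph bases, `Fib(3,2)`, `EC(3,2)`.
NOT Schanuel's conjecture (neither used nor implied; EAC ⇏ SC); `EC(3,2)` stays OPEN.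
-/

noncomputable section

open Filter Topology Set Complex MvPolynomial
open Literature.NumberTheory.Transcendental Literature.ModelTheory.Zilber
open Literature.ModelTheory.ExponentialFields

set_option linter.dupNamespace false

namespace Summit.Schanuel.Schanuel.Theorems

/-! ## Part A. The density theorem -/

section Main

variable (p : Polynomial ℂ) {P : MvPolynomial (Fin 3) ℂ}

/-- **Zariski density for every fibre polynomial involving `y₁`.**  `deg p ≥ 2`;
`P ∈ ℂ[x, y₀, y₁]` irreducible with two monomials of different `y₁`-degree ⟹ the exponential
points of `{x₁ = p(x₀), P(x₀; y₀, y₁) = 0}` are Zariski dense (no balance, equidegree or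
genericity hypothesis).
[cite: MantovaMasser2023, §1 Further remarks, p. 5 (the question, open in general)] (new) -/
theorem unprojectedDense_graphSurface (hd : 2 ≤ p.natDegree) (hirr : Irreducible P)
    (h2 : ∃ m ∈ P.support, ∃ m' ∈ P.support, m 2 ≠ m' 2) :
    UnprojectedDense {w : Fin 2 ⊕ Fin 2 → ℂ | w (Sum.inl 1) = p.eval (w (Sum.inl 0)) ∧
      MvPolynomial.eval ![w (Sum.inl 0), w (Sum.inr 0), w (Sum.inr 1)] P = 0} := by
  obtain ⟨z, hz, hgr⟩ := exists_graphSurface_expPoints p hd P h2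
  exact unprojectedDense_graphSurface_of_expPoints p P hz hgr
    (isIrreducibleClosed_graphSurface p hirr) (by rw [zariskiDim_graphSurface p hirr])

end Main

/-! ## Part B. The case certificate for non-split `W(p; P)` -/

section Case

variable (p : Polynomial ℂ) (P : MvPolynomial (Fin 3) ℂ)

/-- Reading a point of `W(p; P) ∩ G²` off a base point `t` and a torus zero `c` of `P(t; ·)`. -/
theorem elim_mem_graphSurface_inter_torusLocus {t : ℂ} {c : Fin 2 → ℂ} (h0 : c 0 ≠ 0)
    (h1 : c 1 ≠ 0) (hc : MvPolynomial.eval ![t, c 0, c 1] P = 0) :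
    (Sum.elim ![t, p.eval t] c : Fin 2 ⊕ Fin 2 → ℂ) ∈
      {w : Fin 2 ⊕ Fin 2 → ℂ | w (Sum.inl 1) = p.eval (w (Sum.inl 0)) ∧
        MvPolynomial.eval ![w (Sum.inl 0), w (Sum.inr 0), w (Sum.inr 1)] P = 0} ∩
        torusLocus ℂ 2 := by
  refine ⟨⟨by simp, by simpa using hc⟩, ?_⟩
  rw [mem_torusLocus_iff]
  intro i
  fin_cases i
  · simpa using h0
  · simpa using h1

/-- **The additive projection of `W(p; P) ∩ G²` has the same vanishing ideal as the base curve**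
`{x₁ = p(x₀)}` as soon as `P(t; ·)` has a torus zero for infinitely many `t` (a polynomial in
`t` vanishing at infinitely many points vanishes). (new) -/
theorem vanishingIdeal_projAdd_graphSurface
    (hfib : Set.Infinite {t : ℂ | ∃ c : Fin 2 → ℂ, c 0 ≠ 0 ∧ c 1 ≠ 0 ∧
      MvPolynomial.eval ![t, c 0, c 1] P = 0}) :
    vanishingIdeal ℂ (projAdd '' ({w : Fin 2 ⊕ Fin 2 → ℂ | w (Sum.inl 1) = p.eval (w (Sum.inl 0)) ∧
        MvPolynomial.eval ![w (Sum.inl 0), w (Sum.inr 0), w (Sum.inr 1)] P = 0} ∩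
        torusLocus ℂ 2)) =
      vanishingIdeal ℂ (projAdd '' (graphPolySurface p Polynomial.X ∩ torusLocus ℂ 2)) := by
  rw [projAdd_image_graphPolySurface_inter_torusLocus p Polynomial.X_ne_zero]
  refine le_antisymm ?_ (vanishingIdeal_anti_mono ?_)
  · intro F hF
    rw [mem_vanishingIdeal_iff] at hF ⊢
    -- the one-variable polynomial `F(t, p(t))`
    set F₁ : Polynomial ℂ := MvPolynomial.aeval (![Polynomial.X, p] : Fin 2 → Polynomial ℂ) F
      with hF₁
    have hF₁ev : ∀ t : ℂ, F₁.eval t = MvPolynomial.aeval ![t, p.eval t] F := by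
      intro t
      have h1 : (Polynomial.aeval t) F₁ = MvPolynomial.aeval
          (fun i => Polynomial.aeval t ((![Polynomial.X, p] : Fin 2 → Polynomial ℂ) i)) F := by
        rw [hF₁, ← AlgHom.comp_apply, MvPolynomial.comp_aeval]
      have h2 : (fun i => Polynomial.eval t ((![Polynomial.X, p] : Fin 2 → Polynomial ℂ) i)) =
          ![t, p.eval t] := by
        funext i
        fin_cases i <;> simp
      rw [Polynomial.coe_aeval_eq_eval] at h1
      rw [h1, h2]
    have hroots : ∀ t ∈ {t : ℂ | ∃ c : Fin 2 → ℂ, c 0 ≠ 0 ∧ c 1 ≠ 0 ∧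
        MvPolynomial.eval ![t, c 0, c 1] P = 0}, F₁.IsRoot t := by
      rintro t ⟨c, h0, h1, hc⟩
      rw [Polynomial.IsRoot, hF₁ev]
      refine hF _ ⟨Sum.elim ![t, p.eval t] c, elim_mem_graphSurface_inter_torusLocus p P h0 h1 hc,
        ?_⟩
      funext i
      fin_cases i <;> simp [projAdd]
    have hF₁0 : F₁ = 0 :=
      Polynomial.eq_zero_of_infinite_isRoot F₁ (hfib.mono hroots)
    intro x hx
    simp only [graphBase, Set.mem_setOf_eq, eval_polynomial_aeval_X] at hx
    have hx' : x = ![x 0, p.eval (x 0)] := by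
      funext i
      fin_cases i
      · rfl
      · simpa using hx
    rw [hx', ← hF₁ev, hF₁0, Polynomial.eval_zero]
  · rintro _ ⟨w, ⟨hw, -⟩, rfl⟩
    simp only [graphBase, Set.mem_setOf_eq, eval_polynomial_aeval_X]
    simpa [projAdd] using hw.1

/-- **`dim cl π(W(p; P) ∩ G²) = 1`** under the same hypothesis. (new) -/
theorem addProjDim_graphSurface
    (hfib : Set.Infinite {t : ℂ | ∃ c : Fin 2 → ℂ, c 0 ≠ 0 ∧ c 1 ≠ 0 ∧
      MvPolynomial.eval ![t, c 0, c 1] P = 0}) :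
    addProjDim ℂ 2 {w : Fin 2 ⊕ Fin 2 → ℂ | w (Sum.inl 1) = p.eval (w (Sum.inl 0)) ∧
        MvPolynomial.eval ![w (Sum.inl 0), w (Sum.inr 0), w (Sum.inr 1)] P = 0} = (1 : ℕ) := by
  have h := addProjDim_graphPolySurface p Polynomial.X_ne_zero
  unfold addProjDim zariskiDim at h ⊢
  rw [vanishingIdeal_projAdd_graphSurface p P hfib]
  exact h

/-- **The closure of the base is not a line of rational slope** (`deg p ≥ 2`). (new) -/
theorem not_isRationalSlopeLine_graphSurface (hd : 2 ≤ p.natDegree)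
    (hfib : Set.Infinite {t : ℂ | ∃ c : Fin 2 → ℂ, c 0 ≠ 0 ∧ c 1 ≠ 0 ∧
      MvPolynomial.eval ![t, c 0, c 1] P = 0}) :
    ¬ IsRationalSlopeLine (zeroLocus ℂ (vanishingIdeal ℂ
        (projAdd '' ({w : Fin 2 ⊕ Fin 2 → ℂ | w (Sum.inl 1) = p.eval (w (Sum.inl 0)) ∧
          MvPolynomial.eval ![w (Sum.inl 0), w (Sum.inr 0), w (Sum.inr 1)] P = 0} ∩
          torusLocus ℂ 2)))) := by
  rw [vanishingIdeal_projAdd_graphSurface p P hfib]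
  exact not_isRationalSlopeLine_graphPolySurface _ Polynomial.X_ne_zero
    (coeffs_eq_zero_of_two_le_natDegree hd)

/-- **Case certificate for non-split `W(p; P)`.**  `deg p ≥ 2`, `P` irreducible, and `P(t; ·)`
has a zero in `(ℂˣ)²` for infinitely many `t` ⟹ `W(p; P)` is in Mantova–Masser's case
(dim-π-S-1-free). (new) -/
theorem mmCase_graphSurface (hd : 2 ≤ p.natDegree) (hirr : Irreducible P)
    (hfib : Set.Infinite {t : ℂ | ∃ c : Fin 2 → ℂ, c 0 ≠ 0 ∧ c 1 ≠ 0 ∧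
      MvPolynomial.eval ![t, c 0, c 1] P = 0}) :
    MMCaseDimPiOneFree {w : Fin 2 ⊕ Fin 2 → ℂ | w (Sum.inl 1) = p.eval (w (Sum.inl 0)) ∧
        MvPolynomial.eval ![w (Sum.inl 0), w (Sum.inr 0), w (Sum.inr 1)] P = 0} := by
  obtain ⟨t, c, h0, h1, hc⟩ := hfib.nonempty
  exact ⟨isIrreducibleClosed_graphSurface p hirr,
    ⟨_, elim_mem_graphSurface_inter_torusLocus p P h0 h1 hc⟩, zariskiDim_graphSurface p hirr,
    addProjDim_graphSurface p P hfib, not_isRationalSlopeLine_graphSurface p P hd hfib⟩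

/-- **Mantova–Masser's question on the non-split family: case ∧ dense.**  `deg p ≥ 2`, `P`
irreducible with two monomials of different `y₁`-degree and torus fibres over infinitely many base
points ⟹ `W(p; P)` is in case (dim-π-S-1-free) AND its exponential points are Zariski dense.
[cite: MantovaMasser2023, §1 Further remarks, p. 5 (the question, open in general)] (new) -/
theorem unprojectedDensityQuestion_instance_graphSurface (hd : 2 ≤ p.natDegree)
    (hirr : Irreducible P) (h2 : ∃ m ∈ P.support, ∃ m' ∈ P.support, m 2 ≠ m' 2)
    (hfib : Set.Infinite {t : ℂ | ∃ c : Fin 2 → ℂ, c 0 ≠ 0 ∧ c 1 ≠ 0 ∧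
      MvPolynomial.eval ![t, c 0, c 1] P = 0}) :
    MMCaseDimPiOneFree {w : Fin 2 ⊕ Fin 2 → ℂ | w (Sum.inl 1) = p.eval (w (Sum.inl 0)) ∧
        MvPolynomial.eval ![w (Sum.inl 0), w (Sum.inr 0), w (Sum.inr 1)] P = 0} ∧
      UnprojectedDense {w : Fin 2 ⊕ Fin 2 → ℂ | w (Sum.inl 1) = p.eval (w (Sum.inl 0)) ∧
        MvPolynomial.eval ![w (Sum.inl 0), w (Sum.inr 0), w (Sum.inr 1)] P = 0} :=
  ⟨mmCase_graphSurface p P hd hirr hfib, unprojectedDense_graphSurface p hd hirr h2⟩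

/-- **The question holds on the family whenever it is posed** (the case hypothesis is not even
needed for density). (new) -/
theorem unprojectedDense_graphSurface_of_mmCase (hd : 2 ≤ p.natDegree) (hirr : Irreducible P)
    (h2 : ∃ m ∈ P.support, ∃ m' ∈ P.support, m 2 ≠ m' 2)
    (_h : MMCaseDimPiOneFree {w : Fin 2 ⊕ Fin 2 → ℂ | w (Sum.inl 1) = p.eval (w (Sum.inl 0)) ∧
        MvPolynomial.eval ![w (Sum.inl 0), w (Sum.inr 0), w (Sum.inr 1)] P = 0}) :
    UnprojectedDense {w : Fin 2 ⊕ Fin 2 → ℂ | w (Sum.inl 1) = p.eval (w (Sum.inl 0)) ∧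
        MvPolynomial.eval ![w (Sum.inl 0), w (Sum.inr 0), w (Sum.inr 1)] P = 0} :=
  unprojectedDense_graphSurface p hd hirr h2

end Case

/-! ## Part C. Graph bases over the other axis -/

/-- **Bases `x₀ = p(x₁)`.**  The index swap `0 ↔ 1` on both factors carries
`{x₀ = p(x₁), P(x₁; y₀, y₁) = 0}` to `{x₁ = p(x₀), P^τ(x₀; y₀, y₁) = 0}` with `τ = (y₀ y₁)`; hence
for `deg p ≥ 2` and irreducible `P` with two monomials of different `y₀`-degree the exponential
points of `{x₀ = p(x₁), P(x₁; y₀, y₁) = 0}` are Zariski dense. (new) -/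
theorem unprojectedDense_graphSurface_swap (p : Polynomial ℂ) (hd : 2 ≤ p.natDegree)
    {P : MvPolynomial (Fin 3) ℂ} (hirr : Irreducible P)
    (h2 : ∃ m ∈ P.support, ∃ m' ∈ P.support, m 1 ≠ m' 1) :
    UnprojectedDense {w : Fin 2 ⊕ Fin 2 → ℂ | w (Sum.inl 0) = p.eval (w (Sum.inl 1)) ∧
      MvPolynomial.eval ![w (Sum.inl 1), w (Sum.inr 0), w (Sum.inr 1)] P = 0} := by
  classical
  set τ : Fin 3 ≃ Fin 3 := Equiv.swap 1 2 with hτ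
  set P' : MvPolynomial (Fin 3) ℂ := rename τ P with hP'
  have hirr' : Irreducible P' := (MulEquiv.irreducible_iff (renameEquiv ℂ τ)).2 hirr
  have h2' : ∃ m ∈ P'.support, ∃ m' ∈ P'.support, m 2 ≠ m' 2 := by
    obtain ⟨m, hm, m', hm', hne⟩ := h2
    refine ⟨Finsupp.mapDomain τ m, ?_, Finsupp.mapDomain τ m', ?_, ?_⟩
    · rw [hP', support_rename_of_injective τ.injective]; exact Finset.mem_image_of_mem _ hm
    · rw [hP', support_rename_of_injective τ.injective]; exact Finset.mem_image_of_mem _ hm'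
    · have e1 : (2 : Fin 3) = τ 1 := by simp [hτ]
      rw [e1, Finsupp.mapDomain_apply τ.injective, Finsupp.mapDomain_apply τ.injective]
      exact hne
  have hdense := unprojectedDense_graphSurface p hd hirr' h2'
  have hset : indexSwapped {w : Fin 2 ⊕ Fin 2 → ℂ | w (Sum.inl 1) = p.eval (w (Sum.inl 0)) ∧
      MvPolynomial.eval ![w (Sum.inl 0), w (Sum.inr 0), w (Sum.inr 1)] P' = 0} =
      {w : Fin 2 ⊕ Fin 2 → ℂ | w (Sum.inl 0) = p.eval (w (Sum.inl 1)) ∧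
        MvPolynomial.eval ![w (Sum.inl 1), w (Sum.inr 0), w (Sum.inr 1)] P = 0} := by
    ext w
    have e : MvPolynomial.eval ![(w ∘ idxSwap) (Sum.inl 0), (w ∘ idxSwap) (Sum.inr 0),
        (w ∘ idxSwap) (Sum.inr 1)] P' =
        MvPolynomial.eval ![w (Sum.inl 1), w (Sum.inr 0), w (Sum.inr 1)] P := by
      rw [hP', eval_rename]
      have hfun : ((![(w ∘ idxSwap) (Sum.inl 0), (w ∘ idxSwap) (Sum.inr 0),
          (w ∘ idxSwap) (Sum.inr 1)] : Fin 3 → ℂ) ∘ ⇑τ) =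
          ![w (Sum.inl 1), w (Sum.inr 0), w (Sum.inr 1)] := by
        funext i
        fin_cases i <;> simp [hτ, Equiv.swap_apply_of_ne_of_ne]
      rw [hfun]
    simp only [mem_indexSwapped_iff, Set.mem_setOf_eq, e]
    simp
  rw [← hset]
  exact unprojectedDense_indexSwapped hdense

end Summit.Schanuel.Schanuel.Theorems
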